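import Mathlib.Analysis.Convex.Slope
import Mathlib.Tactic

/-!
# Route `AnisotropyChord` / H0 rotor rung — PART N22: the scalar skeleton of THEOREM END₃ (Krein monotone corollary,
# chord–tangent lemma, Δ-cells)

Theory seat `hubbard-h0-rotor-theory-1`, cycle 19 (memo ROTOR-THEORY-19 §236 (c), §244), typed for the S-bridge dossier of
stmt-HubbardSuperconductivity-19089.  Mathlib-only, abstract real-variable statements; PROVED here (no `sorry`):

* `fixedPoint_ge_of_antitone` (PROP K3 (c), the MONOTONE COROLLARY): if the secular function `Φ` is antitone and `t⋆ = Φ t⋆`,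
  then `T ≤ Φ T → T ≤ t⋆`.  This is the logical form in which every lower bound on a lift is certified in memo 19
  (`Φ₁(T) ≥ T ⇒ t₁ ≥ T`), and dually `fixedPoint_le_of_antitone` (`Φ T ≤ T ⇒ t⋆ ≤ T`).
* `lift_ge_chord` (LEMMA CT, chord half): a lift `t₁` concave on `[Δb, 1]` with `t₁ 1 ≥ 0` satisfies
  `t₁ Δ ≥ (1 - Δ) / (1 - Δb) * t₁ Δb` on `[Δb, 1]`.
* `end_on_upper_interval` (LEMMA CT): chord for `t₁` + tangent bound `t₀ Δ ≤ (1 - Δ) * c` + the single number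
  `t₁ Δb ≥ (1 - Δb) * c` give `t₀ ≤ t₁` on the whole interval `[Δb, 1]`.
* `end_on_cell` (LEMMA CELL): `t₀, t₁` antitone on `[a, b]` and `t₀ a ≤ t₁ b` give `t₀ ≤ t₁` on `[a, b]`.
* `ratio_monotoneOn_of_concaveOn` (three-chord lemma): `t` concave on `[a, 1]` with `t 1 = 0` ⇒ `Δ ↦ t Δ / (1 - Δ)` is
  monotone on `[a, 1)`;  `end_on_sCell` (LEMMA s-CELL).

Nothing here is specific to three particles: `t₀, t₁, Φ` are real functions supplied by the spectral theory of the memo.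

PORT (prover seat `hubbard-h0-rotor-p1` g20): theory seat file `cycle19/lean/PartN22.lean` (sha16 675a59adb76c39a0) verbatim,
except the import line (narrowed from `import Mathlib`), `set_option linter.dupNamespace false`, and `push_neg` → `push Not`.  Helper file for the S-bridge
dossier of stmt-HubbardSuperconductivity-19089; it closes no item.  No definition is introduced.
-/

set_option linter.dupNamespace false

namespace Summit.HubbardSuperconductivity.HubbardSuperconductivity.Theorems.AnisotropyChord.Transfer.Krein

/-! ## PROP K3 (c): the monotone corollary -/

/-- MONOTONE COROLLARY (PROP K3 (c)): for an antitone secular function, `T ≤ Φ T` forces `T ≤ t⋆` for every fixed point `t⋆`. -/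
theorem fixedPoint_ge_of_antitone {Φ : ℝ → ℝ} (hΦ : Antitone Φ) {tstar T : ℝ}
    (hfix : Φ tstar = tstar) (hT : T ≤ Φ T) : T ≤ tstar := by
  by_contra h
  push Not at h
  have h1 : Φ T ≤ Φ tstar := hΦ h.le
  linarith

/-- The same on a set: `Φ` antitone on `S ∋ T, t⋆`. -/
theorem fixedPoint_ge_of_antitoneOn {Φ : ℝ → ℝ} {S : Set ℝ} (hΦ : AntitoneOn Φ S) {tstar T : ℝ}
    (hts : tstar ∈ S) (hTS : T ∈ S) (hfix : Φ tstar = tstar) (hT : T ≤ Φ T) : T ≤ tstar := by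
  by_contra h
  push Not at h
  have h1 : Φ T ≤ Φ tstar := hΦ hts hTS h.le
  linarith

/-- Dual form (upper bounds on a lift): `Φ T ≤ T` forces `t⋆ ≤ T`. -/
theorem fixedPoint_le_of_antitone {Φ : ℝ → ℝ} (hΦ : Antitone Φ) {tstar T : ℝ}
    (hfix : Φ tstar = tstar) (hT : Φ T ≤ T) : tstar ≤ T := by
  by_contra h
  push Not at h
  have h1 : Φ tstar ≤ Φ T := hΦ h.le
  linarith

/-- Sandwich: a minorant certificate at `T⁻` and a majorant certificate at `T⁺` locate the fixed point. -/
theorem fixedPoint_mem_Icc_of_antitone {Φ : ℝ → ℝ} (hΦ : Antitone Φ) {tstar Tm Tp : ℝ}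
    (hfix : Φ tstar = tstar) (hm : Tm ≤ Φ Tm) (hp : Φ Tp ≤ Tp) : tstar ∈ Set.Icc Tm Tp :=
  ⟨fixedPoint_ge_of_antitone hΦ hfix hm, fixedPoint_le_of_antitone hΦ hfix hp⟩

/-- END from two certificates: if `Φ₀ T ≤ T` (so `t₀ ≤ T`) and `T ≤ Φ₁ T` (so `T ≤ t₁`) then `t₀ ≤ t₁`. -/
theorem lift_order_of_certificates {Φ₀ Φ₁ : ℝ → ℝ} (h₀ : Antitone Φ₀) (h₁ : Antitone Φ₁) {t₀ t₁ T : ℝ}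
    (hfix₀ : Φ₀ t₀ = t₀) (hfix₁ : Φ₁ t₁ = t₁) (hup : Φ₀ T ≤ T) (hlow : T ≤ Φ₁ T) : t₀ ≤ t₁ :=
  le_trans (fixedPoint_le_of_antitone h₀ hfix₀ hup) (fixedPoint_ge_of_antitone h₁ hfix₁ hlow)

/-! ## LEMMA CT (chord–tangent) and the Δ-cells -/

/-- Chord half of LEMMA CT: a concave lift with `t₁ 1 ≥ 0` lies above its chord to `(1, 0)`. -/
theorem lift_ge_chord {t₁ : ℝ → ℝ} {Δb : ℝ} (hb : Δb < 1)
    (hconc : ConcaveOn ℝ (Set.Icc Δb 1) t₁) (h1 : 0 ≤ t₁ 1) {Δ : ℝ} (hΔ : Δ ∈ Set.Icc Δb 1) :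
    (1 - Δ) / (1 - Δb) * t₁ Δb ≤ t₁ Δ := by
  obtain ⟨hΔl, hΔr⟩ := hΔ
  have hpos : 0 < 1 - Δb := by linarith
  set θ : ℝ := (1 - Δ) / (1 - Δb) with hθ
  have hθ0 : 0 ≤ θ := div_nonneg (by linarith) hpos.le
  have hθ1 : θ ≤ 1 := by
    rw [hθ, div_le_one hpos]; linarith
  have hmemb : Δb ∈ Set.Icc Δb 1 := ⟨le_rfl, hb.le⟩
  have hmem1 : (1:ℝ) ∈ Set.Icc Δb 1 := ⟨hb.le, le_rfl⟩
  have hcomb : θ • Δb + (1 - θ) • (1:ℝ) = Δ := by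
    simp only [smul_eq_mul]
    rw [hθ]; field_simp; ring
  have key := hconc.2 hmemb hmem1 hθ0 (by linarith) (by ring : θ + (1 - θ) = 1)
  rw [hcomb] at key
  simp only [smul_eq_mul] at key
  have h2 : 0 ≤ (1 - θ) * t₁ 1 := mul_nonneg (by linarith) h1
  linarith

/-- LEMMA CT: END on the whole upper interval `[Δb, 1]` from ONE number.  Hypotheses: tangent bound for the ground lift
`t₀ Δ ≤ (1 - Δ) * c` (uniform trial state in the `Δ = 1` multiplet, `c = 12/(V-1)` for three particles), concavity of `t₁`
with `t₁ 1 ≥ 0`, and `t₁ Δb ≥ (1 - Δb) * c`. -/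
theorem end_on_upper_interval {t₀ t₁ : ℝ → ℝ} {Δb c : ℝ} (hb : Δb < 1)
    (htan : ∀ Δ ∈ Set.Icc Δb 1, t₀ Δ ≤ (1 - Δ) * c)
    (hconc : ConcaveOn ℝ (Set.Icc Δb 1) t₁) (h1 : 0 ≤ t₁ 1)
    (hnum : (1 - Δb) * c ≤ t₁ Δb) :
    ∀ Δ ∈ Set.Icc Δb 1, t₀ Δ ≤ t₁ Δ := by
  intro Δ hΔ
  have hpos : 0 < 1 - Δb := by linarith
  have hch := lift_ge_chord hb hconc h1 hΔ
  have hfac : 0 ≤ (1 - Δ) / (1 - Δb) := div_nonneg (by linarith [hΔ.2]) hpos.le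
  have h3 : (1 - Δ) / (1 - Δb) * ((1 - Δb) * c) ≤ (1 - Δ) / (1 - Δb) * t₁ Δb :=
    mul_le_mul_of_nonneg_left hnum hfac
  have h4 : (1 - Δ) / (1 - Δb) * ((1 - Δb) * c) = (1 - Δ) * c := by
    field_simp
  linarith [htan Δ hΔ]

/-- LEMMA CELL: both lifts antitone in `Δ`; one comparison of endpoint values gives END on the cell. -/
theorem end_on_cell {t₀ t₁ : ℝ → ℝ} {a b : ℝ}
    (h₀ : AntitoneOn t₀ (Set.Icc a b)) (h₁ : AntitoneOn t₁ (Set.Icc a b)) (hnum : t₀ a ≤ t₁ b) :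
    ∀ Δ ∈ Set.Icc a b, t₀ Δ ≤ t₁ Δ := by
  intro Δ hΔ
  have hab : a ≤ b := le_trans hΔ.1 hΔ.2
  have ha : a ∈ Set.Icc a b := ⟨le_rfl, hab⟩
  have hbm : b ∈ Set.Icc a b := ⟨hab, le_rfl⟩
  calc t₀ Δ ≤ t₀ a := h₀ ha hΔ hΔ.1
    _ ≤ t₁ b := hnum
    _ ≤ t₁ Δ := h₁ hΔ hbm hΔ.2

/-- Three-chord lemma: a concave lift vanishing at `Δ = 1` has `Δ ↦ t Δ / (1 - Δ)` monotone on `[a, 1)`. -/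
theorem ratio_monotoneOn_of_concaveOn {t : ℝ → ℝ} {a : ℝ} (ha : a < 1)
    (hconc : ConcaveOn ℝ (Set.Icc a 1) t) (h1 : t 1 = 0) :
    MonotoneOn (fun Δ => t Δ / (1 - Δ)) (Set.Ico a 1) := by
  intro x hx y hy hxy
  have hx1 : x ≠ 1 := ne_of_lt hx.2
  have hy1 : y ≠ 1 := ne_of_lt hy.2
  have hconv : ConvexOn ℝ (Set.Icc a 1) (-t) := hconc.neg
  have hmem1 : (1:ℝ) ∈ Set.Icc a 1 := ⟨ha.le, le_rfl⟩
  have hxm : x ∈ Set.Icc a 1 := ⟨hx.1, hx.2.le⟩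
  have hym : y ∈ Set.Icc a 1 := ⟨hy.1, hy.2.le⟩
  have key := hconv.secant_mono hmem1 hxm hym hx1 hy1 hxy
  -- key : ((-t) x - (-t) 1) / (x - 1) ≤ ((-t) y - (-t) 1) / (y - 1)
  simp only [Pi.neg_apply, h1, neg_zero, sub_zero] at key
  have ex : (-t x) / (x - 1) = t x / (1 - x) := by
    rw [show (1:ℝ) - x = -(x - 1) by ring, div_neg, neg_div]
  have ey : (-t y) / (y - 1) = t y / (1 - y) := by
    rw [show (1:ℝ) - y = -(y - 1) by ring, div_neg, neg_div]
  simpa [ex, ey] using key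

/-- LEMMA s-CELL: with `s_K := t_K / (1 - Δ)` monotone, `s₁ a ≥ s₀ b` gives END on `[a, b]` (`b < 1`). -/
theorem end_on_sCell {t₀ t₁ : ℝ → ℝ} {a b : ℝ} (hb1 : b < 1)
    (h₀ : MonotoneOn (fun Δ => t₀ Δ / (1 - Δ)) (Set.Icc a b))
    (h₁ : MonotoneOn (fun Δ => t₁ Δ / (1 - Δ)) (Set.Icc a b))
    (hnum : t₀ b / (1 - b) ≤ t₁ a / (1 - a)) :
    ∀ Δ ∈ Set.Icc a b, t₀ Δ ≤ t₁ Δ := by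
  intro Δ hΔ
  have hab : a ≤ b := le_trans hΔ.1 hΔ.2
  have ha : a ∈ Set.Icc a b := ⟨le_rfl, hab⟩
  have hbm : b ∈ Set.Icc a b := ⟨hab, le_rfl⟩
  have hpos : 0 < 1 - Δ := by linarith [hΔ.2]
  have key : t₀ Δ / (1 - Δ) ≤ t₁ Δ / (1 - Δ) :=
    calc t₀ Δ / (1 - Δ) ≤ t₀ b / (1 - b) := h₀ hΔ hbm hΔ.2
      _ ≤ t₁ a / (1 - a) := hnum
      _ ≤ t₁ Δ / (1 - Δ) := h₁ ha hΔ hΔ.1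
  exact (div_le_div_iff_of_pos_right hpos).mp key

end Summit.HubbardSuperconductivity.HubbardSuperconductivity.Theorems.AnisotropyChord.Transfer.Krein
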